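/-
Copyright: derived here (Resolution Observatory cell `pub-rosobs`, carver gen 46). AI-written Lean; AI review is
weaker than expert review.  Typed statements in the cell's POLYNOMIAL weighted-centre model `W(f)` — an instrument,
NOT a resolution theorem and NOT a statement about the invariant of [AbramovichTemkinWlodarczyk2024] on power series.
-/
import Literature.AlgebraicGeometry.Resolution.WeightedCentreFaceEquation
import Literature.AlgebraicGeometry.Resolution.WeightedCentreUpperPins
import HarnessLib

/-!
# Twist depth: a maximal centre whose maximal-rate parts are twisted translations against an absorber
# `ε_b ↦ ε_b + c·t^S` satisfies `(1 + S·d)·S·θ ≤ 1`, hence `(1 + S·d)·S < q`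

Companion to `WeightedCentreFaceEquation` (Lemma Q, the face equation) and `WeightedCentreUpperPins` (every centre
variable of a maximal centre is upper-pinned).  This file types, in the cell's polynomial model `W(f)`, the
"twist-depth" bound of the cell's engine 1 (generation 29, its Theorem R): the one mechanism by which every bent
maximal centre the cell has found absorbs its shift — a Frobenius twist `ε_b ↦ ε_b + c·t^{p^k}` paid for by
`t`-linear shifts `ε_i ↦ ε_i + t·M_i(ε)` of other slots — needs room `q > p^k (d p^k + 1)`, `d` the least degree of
the `M_i`; so `q ≥ p^{2k+1}`, and at `q = p²` the mechanism bends no maximal centre.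

[ATW24] Abramovich–Temkin–Włodarczyk, *Functorial embedded resolution via weighted blowings up*, Algebra & Number
Theory 18 (2024): §5.1 (p. 1575), Def. 2.4.1 (2) and Rem. 2.4.2 (p. 1568), Lemma 5.2.10 (p. 1577), Thm. 5.3.1 (2)
(p. 1578: `inv = max` over admissible centres).  [CJS20] Cossart–Jannsen–Saito, LNM 2270 (2020), §2.2 (p. 21: initial
forms in `gr`), Def. 1.26.  [Hau10] Hauser, *On the problem of resolution of singularities in positive
characteristic*, Bull. AMS 47 (2010), §D (p. 12: oblique polynomials, the `t^{p^k}`-translation phenomenon).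

## Setting (as in `WeightedCentreFaceEquation`; `k` a field, variables `Fin N`, no hypothesis on the characteristic)

`f = X_a^q + h`, `h` free of `X_a`; a centre `(Ψ, w)` for `f` with ambient coordinates `Y i = Ψ⁻¹ Xᵢ` in inverse normal
form relative to `a` (`Y a = X a =: t`); the θ-grading `D` (`D a = L > 0`, `D_i θ = L w_i`, `E₀ θ = L`) with `w_a < θ`,
dominated by `Y`; the face `h₀ = weightedHomogeneousComponent D E₀ h` and the maximal-rate parts
`θ_Y i = weightedHomogeneousComponent D (D i) (Y i)`.  NOTATION CLASH: here `a` is the `t`-slot (the tree's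
convention) and the ABSORBER is called `b`; engine 1 calls the absorber `a`.

A **twisted translation** (`twistedTranslation a b M c S`) is the family `T a = X a`, `T b = X b + c·X_a^S`
(the absorber, `c ≠ 0`, `S ≥ 1`; think `S = p^k`), `T i = X i + X a·M i` otherwise (`M i = 0` on the unshifted slots),
with every `M i` free of `X_a` and `X_b`.

## What is proved (all "(derived here)")

* §1 `aeval_shiftPart_eq_aeval_absorberSubst` — the KEY IDENTITY (E1 g29 §4.A (3)): if `Φ` is free of `X_a` and
  `Φ ∘ T = Φ`, then substituting `ε_b ↦ −c t^S` gives `Φ(ε + t·M, ε_b := 0) = Φ(ε_b := −c t^S)`.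
* §2 `twistAdm_of_mem_support_aeval` — DIVISIBILITY: every monomial `t^n ε^ρ` of `Φ(ε + t·M, ε_b := 0)` carries a list
  of `n` monomials of the `M_i` whose product divides `ε^ρ` (bookkeeping predicate `TwistAdm`).
* §3 `coeff_twistExp_aeval_absorberSubst` — COEFFICIENT EXTRACTION: for `μ ∈ supp Φ` with `μ_b = j`, the monomial
  `twistExp μ = (μ with ε_b^j replaced by t^{jS})` of `Φ(ε_b := −c t^S)` has coefficient `(−c)^j·coeff μ Φ`
  (`twistExp` is injective on exponents free of `a` because `S ≥ 1`).
* §4 **`le_monomialValuation_of_twistedTranslation`** (the core inequality): `Φ` free of `X_a`, `Φ ∘ T = Φ`, `w ≥ 0`,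
  every monomial of every `M i` of degree `≥ d`; if `μ ∈ supp Φ` has `μ_b ≥ 1` and all its variables of weight `≥ w_b`
  (an UPPER PIN of `b`), then `(1 + S·d)·w_b ≤ v_w(μ)`.
* §5 **`twistDepth_mul_theta_le_one`** (THEOREM R in the model): for a centre `(Ψ, w)` of `X_a^q + h` attaining
  `max W(f)`, in inverse normal form, with `1 < q·θ` (not `T`-tight) and maximal-rate parts `θ_Y = twistedTranslation
  a b M c S` (`w_b > 0`): `w_b = S·θ` (`weight_eq_of_top_absorber`) and `(1 + S·d)·S·θ ≤ 1`; hence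
  `twistDepth_mul_lt`: `(1 + S·d)·S < q`.  Inputs: Lemma Q (`IsInverseNormalForm.face_equation`, indicator `0` as
  `q θ ≠ 1`) and the upper pin of `b` (`exists_upperPin_of_isMaxInv`, engine 1's Lemma L3).
* §6 `twistDepth_exponent` (`S = p^κ`, `d ≥ 1`, `q = p^e` ⇒ `2κ + 1 ≤ e`), `not_twistDepth_at_sq` (`κ ≥ 1` is impossible
  at `e = 2`), and SHARPNESS in characteristic `p`: for the face `X₁^p + X₂^{mp}·X₃` with `T = (t; X₁ + t X₂^m, X₂,
  X₃ − t^p)` (`S = p`, `d = m`, pin `X₂^{mp} X₃`, `w = (0; 1/p, 1/(mp+1), 1/(mp+1))`) the core inequality is an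
  EQUALITY `(1 + p m)·w₃ = 1 = v_w(pin)` (`aeval_twistedTranslation_sharpFace`, `sharp_core_equality`); the strict
  bound then reads `p(mp+1) < q`, which is exactly the hypothesis `mp + 1 < p^c` (`q = p^{c+1}`) under which
  `WeightedCentreBentFamilyRankOne.exists_isTTight_and_not_isTTight_centre` exhibits such a bent maximal centre.

NOT typed here (they stay hypotheses `1 ≤ S`, `d`): engine 1's steps "(1) `k ≥ 1`" and "(2) every `M_i` is
non-constant", which rest on its linearisation lemma L1; nor the entry bounds `p^k ≤ a_i < q/(d_i p^k + 1)`.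
Value type: typed lemmas in the polynomial `W(f)` model — not a resolution theorem.
-/

noncomputable section

open MvPolynomial
open Finsupp (weight)

namespace Literature.AlgebraicGeometry.Resolution

namespace WeightedBlowup

variable {k : Type*} [Field k] {N : ℕ}

/-! ## §0 Plumbing -/

/-- A variable absent from `P` has exponent `0` in every monomial of `P` (plumbing). [folklore] -/
private theorem apply_eq_zero_of_notMem_vars₄₆ {P : MvPolynomial (Fin N) k} {a : Fin N} (hP : a ∉ P.vars)
    {β : Fin N →₀ ℕ} (hβ : β ∈ P.support) : β a = 0 := by
  by_contra hne
  exact hP ((mem_vars_iff_mem_support a).mpr ⟨β, hβ, Finsupp.mem_support_iff.mpr hne⟩)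

/-- The layers of a polynomial free of `X_a` are free of `X_a` (plumbing). [folklore] -/
private theorem notMem_vars_weightedHomogeneousComponent₄₆ {a : Fin N} {P : MvPolynomial (Fin N) k}
    (hP : a ∉ P.vars) (D : Fin N → ℕ) (m : ℕ) : a ∉ (weightedHomogeneousComponent D m P).vars := by
  classical
  intro ha
  obtain ⟨d, hd, had⟩ := (mem_vars_iff_mem_support a).mp ha
  rw [mem_support_iff, coeff_weightedHomogeneousComponent] at hd
  split_ifs at hd with hw
  · exact Finsupp.mem_support_iff.mp had (apply_eq_zero_of_notMem_vars₄₆ hP (mem_support_iff.mpr hd))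
  · exact hd rfl

/-- Two substitutions that agree off `X_a` agree on a polynomial free of `X_a` (plumbing). [folklore] -/
private theorem aeval_congr_of_notMem_vars₄₆ {a : Fin N} (G G' : Fin N → MvPolynomial (Fin N) k)
    (hG : ∀ i, i ≠ a → G i = G' i) {P : MvPolynomial (Fin N) k} (hP : a ∉ P.vars) :
    aeval G P = aeval G' P := by
  change (aeval G : MvPolynomial (Fin N) k →ₐ[k] MvPolynomial (Fin N) k).toRingHom P =
    (aeval G' : MvPolynomial (Fin N) k →ₐ[k] MvPolynomial (Fin N) k).toRingHom P
  refine hom_congr_vars ?_ (fun i hi _ => ?_) rfl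
  · ext r
    simp
  · have hia : i ≠ a := fun h => hP (h ▸ hi)
    change aeval G (X i) = aeval G' (X i)
    rw [aeval_X, aeval_X, hG i hia]

/-- A substitution fixing every variable except `X_b` fixes a polynomial free of `X_b` (plumbing). [folklore] -/
private theorem aeval_eq_self_of_notMem_vars₄₆ {b : Fin N} (G : Fin N → MvPolynomial (Fin N) k)
    (hG : ∀ i, i ≠ b → G i = X i) {P : MvPolynomial (Fin N) k} (hP : b ∉ P.vars) : aeval G P = P := by
  rw [aeval_congr_of_notMem_vars₄₆ G X hG hP, aeval_X_left_apply]

/-- `v_w` is additive (plumbing). [folklore] -/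
private theorem monomialValuation_add₄₆ (w : Fin N → ℚ) (d₁ d₂ : Fin N →₀ ℕ) :
    monomialValuation w (d₁ + d₂) = monomialValuation w d₁ + monomialValuation w d₂ := by
  simp only [monomialValuation_eq_sum, Finsupp.add_apply, Nat.cast_add, add_mul, Finset.sum_add_distrib]

/-- `v_w` is monotone when `w ≥ 0` (plumbing). [folklore] -/
private theorem monomialValuation_mono₄₆ (w : Fin N → ℚ) (hw : ∀ i, 0 ≤ w i) {d₁ d₂ : Fin N →₀ ℕ}
    (h : d₁ ≤ d₂) : monomialValuation w d₁ ≤ monomialValuation w d₂ := by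
  simp only [monomialValuation_eq_sum]
  exact Finset.sum_le_sum fun i _ => mul_le_mul_of_nonneg_right (by exact_mod_cast Finsupp.le_def.mp h i) (hw i)

/-- `v_w(X_b^j) = j·w_b` (plumbing). [folklore] -/
private theorem monomialValuation_single₄₆ (w : Fin N → ℚ) (b : Fin N) (j : ℕ) :
    monomialValuation w (Finsupp.single b j) = j * w b := by
  unfold monomialValuation
  rw [Finsupp.sum_single_index]
  simp

/-- `v_w` of a list sum is the sum of the values (plumbing). [folklore] -/
private theorem monomialValuation_list_sum₄₆ (w : Fin N → ℚ) (l : List (Fin N →₀ ℕ)) :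
    monomialValuation w l.sum = (l.map (monomialValuation w)).sum := by
  induction l with
  | nil => simp [monomialValuation]
  | cons e l ih => rw [List.sum_cons, List.map_cons, List.sum_cons, monomialValuation_add₄₆, ih]

/-- A list sum is at least its length times a common lower bound (plumbing). [folklore] -/
private theorem length_mul_le_sum₄₆ (l : List ℚ) (c : ℚ) (h : ∀ x ∈ l, c ≤ x) :
    (l.length : ℚ) * c ≤ l.sum := by
  induction l with
  | nil => simp
  | cons x l ih =>
    rw [List.length_cons, List.sum_cons, Nat.cast_succ, add_mul, one_mul]
    have hx := h x (List.mem_cons.mpr (Or.inl rfl))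
    have hl := ih fun y hy => h y (List.mem_cons.mpr (Or.inr hy))
    linarith

/-- On a monomial all of whose variables have weight `≥ c`: `deg(e)·c ≤ v_w(e)` (plumbing). [folklore] -/
private theorem degree_mul_le_monomialValuation₄₆ (w : Fin N → ℚ) {c : ℚ} (e : Fin N →₀ ℕ)
    (h : ∀ i, e i ≠ 0 → c ≤ w i) : ((Finsupp.degree e : ℕ) : ℚ) * c ≤ monomialValuation w e := by
  rw [monomialValuation_eq_sum, Finsupp.degree_eq_sum, Nat.cast_sum, Finset.sum_mul]
  refine Finset.sum_le_sum fun i _ => ?_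
  by_cases hi : e i = 0
  · simp [hi]
  · exact mul_le_mul_of_nonneg_left (h i hi) (Nat.cast_nonneg _)

/-! ## §1 Twisted translations, the absorber substitution, and the KEY IDENTITY -/

section Twist

variable (a b : Fin N) (M : Fin N → MvPolynomial (Fin N) k) (c : k) (S : ℕ)

/-- **Twisted translation** (the top arc system of E1 g29 §4.A, in the tree's convention `t = X_a`, absorber `b`):
`T a = X a`, `T b = X b + c·X_a^S` (the absorber `ε_b ↦ ε_b + c t^S`), `T i = X i + X_a·M i` otherwise (`ε_i ↦
ε_i + t M_i(ε)`; `M i = 0` on the unshifted slots).  (derived here: a hypothesis SHAPE of the polynomial model)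
[cite: Hauser2010, §D (p. 12)] [cite: AbramovichTemkinWlodarczyk2024, §5.1 (p. 1575)] -/
def twistedTranslation : Fin N → MvPolynomial (Fin N) k :=
  fun i => if i = a then X a else if i = b then X b + C c * X a ^ S else X i + X a * M i

/-- The **absorber substitution** `ε_b ↦ −c·t^S`, every other variable fixed (E1 g29 §4.A (3)). (derived here)
[cite: Hauser2010, §D (p. 12)] -/
def absorberSubst : Fin N → MvPolynomial (Fin N) k :=
  fun i => if i = b then -(C c * X a ^ S) else X i

/-- The **shift part** of a twisted translation with the `t`-slot and the absorber killed: `a ↦ 0`, `b ↦ 0`,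
`i ↦ X i + X_a·M i` (substituting it into a `Φ` free of `X_a` gives `Φ(ε + t·M, ε_b := 0)`). (derived here)
[cite: Hauser2010, §D (p. 12)] -/
def shiftPart : Fin N → MvPolynomial (Fin N) k :=
  fun i => if i = a then 0 else if i = b then 0 else X i + X a * M i

variable {a b M c S}

/-- `T a = X a`. (derived here) [cite: Hauser2010, §D (p. 12)] -/
@[simp] theorem twistedTranslation_self : twistedTranslation a b M c S a = X a := by
  simp [twistedTranslation]

/-- `T b = X b + c·X_a^S`. (derived here) [cite: Hauser2010, §D (p. 12)] -/
theorem twistedTranslation_absorber (hab : a ≠ b) : twistedTranslation a b M c S b = X b + C c * X a ^ S := by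
  simp [twistedTranslation, hab.symm]

/-- `T i = X i + X_a·M i` off `a, b`. (derived here) [cite: Hauser2010, §D (p. 12)] -/
theorem twistedTranslation_of_ne {i : Fin N} (hia : i ≠ a) (hib : i ≠ b) :
    twistedTranslation a b M c S i = X i + X a * M i := by
  simp [twistedTranslation, hia, hib]

/-- The absorber substitution at `b`. (derived here) [cite: Hauser2010, §D (p. 12)] -/
@[simp] theorem absorberSubst_self : absorberSubst a b c S b = -(C c * X a ^ S) := by
  simp [absorberSubst]

/-- The absorber substitution fixes every other variable. (derived here) [cite: Hauser2010, §D (p. 12)] -/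
theorem absorberSubst_of_ne {i : Fin N} (hib : i ≠ b) : absorberSubst a b c S i = X i := by
  simp [absorberSubst, hib]

/-- The shift part kills `t`. (derived here) [cite: Hauser2010, §D (p. 12)] -/
@[simp] theorem shiftPart_self : shiftPart a b M a = 0 := by
  simp [shiftPart]

/-- The shift part kills the absorber. (derived here) [cite: Hauser2010, §D (p. 12)] -/
@[simp] theorem shiftPart_absorber : shiftPart a b M b = 0 := by
  simp [shiftPart]

/-- The shift part off `a, b`. (derived here) [cite: Hauser2010, §D (p. 12)] -/
theorem shiftPart_of_ne {i : Fin N} (hia : i ≠ a) (hib : i ≠ b) : shiftPart a b M i = X i + X a * M i := by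
  simp [shiftPart, hia, hib]

/-- **KEY IDENTITY (E1 g29 §4.A step (3)).**  If `Φ` is free of `X_a` and FIXED by the twisted translation,
`Φ ∘ T = Φ` (this is Lemma Q with indicator `0`), and the `M i` are free of `X_b`, then substituting the absorber
variable by `−c·t^S` gives `Φ(ε + t·M, ε_b := 0) = Φ(ε_b := −c·t^S)`:  `aeval shiftPart Φ = aeval absorberSubst Φ`.
Proof: apply `absorberSubst` to `Φ ∘ T = Φ`; on the left `T b ↦ −c t^S + c t^S = 0`. (derived here)
[cite: Hauser2010, §D (p. 12)] [cite: AbramovichTemkinWlodarczyk2024, Lemma 5.2.10 (p. 1577)] -/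
theorem aeval_shiftPart_eq_aeval_absorberSubst (hab : a ≠ b) (hMb : ∀ i, i ≠ a → i ≠ b → b ∉ (M i).vars)
    {Φ : MvPolynomial (Fin N) k} (hΦ : a ∉ Φ.vars) (hfix : aeval (twistedTranslation a b M c S) Φ = Φ) :
    aeval (shiftPart a b M) Φ = aeval (absorberSubst a b c S) Φ := by
  have h1 : aeval (absorberSubst a b c S) (aeval (twistedTranslation a b M c S) Φ) =
      aeval (absorberSubst a b c S) Φ := by rw [hfix]
  rw [comp_aeval_apply] at h1
  rw [← h1]
  refine aeval_congr_of_notMem_vars₄₆ _ _ (fun i hia => ?_) hΦ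
  by_cases hib : i = b
  · rw [hib, shiftPart_absorber, twistedTranslation_absorber hab, map_add, map_mul, map_pow, aeval_C, aeval_X,
      aeval_X, absorberSubst_self, absorberSubst_of_ne hab, algebraMap_eq, neg_add_cancel]
  · rw [shiftPart_of_ne hia hib, twistedTranslation_of_ne hia hib, map_add, map_mul, aeval_X, aeval_X,
      absorberSubst_of_ne hib, absorberSubst_of_ne hab,
      aeval_eq_self_of_notMem_vars₄₆ _ (fun j hj => absorberSubst_of_ne hj) (hMb i hia hib)]

end Twist

/-! ## §2 Divisibility: the `t`-degree of a monomial of `Φ(ε + t·M, ε_b := 0)` counts factors taken from the `M_i` -/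

section Adm

/-- Bookkeeping predicate: the exponent `ν` (`t`-degree `ν_a`) is accompanied by a list of `ν_a` exponents from `B`
(the monomials of the `M_i`) whose sum, together with `t^{ν_a}`, lies below `ν`.  This is E1 g29 §4.A (3): "every
monomial of `[h₁]_j` is divisible by a product `m_1 ⋯ m_{j p^k}` of monomials of the `M_i`". (derived here)
[cite: Hauser2010, §D (p. 12)] -/
def TwistAdm (a : Fin N) (B : Finset (Fin N →₀ ℕ)) (ν : Fin N →₀ ℕ) : Prop :=
  ∃ l : List (Fin N →₀ ℕ), (∀ e ∈ l, e ∈ B) ∧ l.length = ν a ∧ l.sum + Finsupp.single a (ν a) ≤ ν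

/-- The zero exponent is admissible (empty list). (derived here) [cite: Hauser2010, §D (p. 12)] -/
theorem twistAdm_zero (a : Fin N) (B : Finset (Fin N →₀ ℕ)) : TwistAdm a B 0 :=
  ⟨[], by simp, by simp, by simp⟩

/-- Admissible exponents are closed under addition (concatenate the lists). (derived here) [cite: Hauser2010, §D (p. 12)] -/
theorem TwistAdm.add {a : Fin N} {B : Finset (Fin N →₀ ℕ)} {ν₁ ν₂ : Fin N →₀ ℕ} (h₁ : TwistAdm a B ν₁)
    (h₂ : TwistAdm a B ν₂) : TwistAdm a B (ν₁ + ν₂) := by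
  obtain ⟨l₁, hB₁, hlen₁, hle₁⟩ := h₁
  obtain ⟨l₂, hB₂, hlen₂, hle₂⟩ := h₂
  refine ⟨l₁ ++ l₂, fun e he => ?_, ?_, ?_⟩
  · rcases List.mem_append.mp he with he | he
    exacts [hB₁ e he, hB₂ e he]
  · rw [List.length_append, hlen₁, hlen₂, Finsupp.add_apply]
  · rw [List.sum_append, Finsupp.add_apply, Finsupp.single_add]
    calc l₁.sum + l₂.sum + (Finsupp.single a (ν₁ a) + Finsupp.single a (ν₂ a))
        = (l₁.sum + Finsupp.single a (ν₁ a)) + (l₂.sum + Finsupp.single a (ν₂ a)) := by abel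
      _ ≤ ν₁ + ν₂ := add_le_add hle₁ hle₂

/-- **Divisibility.**  If every monomial of every `G i` is admissible, so is every monomial of `Φ(G)` for every `Φ`
(induction on `Φ`: constants, sums, and products with a variable). (derived here) [cite: Hauser2010, §D (p. 12)] -/
theorem twistAdm_of_mem_support_aeval (a : Fin N) (B : Finset (Fin N →₀ ℕ)) (G : Fin N → MvPolynomial (Fin N) k)
    (hG : ∀ i, ∀ ν ∈ (G i).support, TwistAdm a B ν) (Φ : MvPolynomial (Fin N) k) :
    ∀ ν ∈ (aeval G Φ).support, TwistAdm a B ν := by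
  classical
  refine MvPolynomial.induction_on (motive := fun Φ => ∀ ν ∈ (aeval G Φ).support, TwistAdm a B ν) Φ
    (fun r ν hν => ?_) (fun p q hp hq ν hν => ?_) (fun p i hp ν hν => ?_)
  · rw [aeval_C, algebraMap_eq, mem_support_iff, coeff_C] at hν
    split_ifs at hν with h0
    · rw [← h0]
      exact twistAdm_zero a B
    · exact absurd rfl hν
  · rw [map_add] at hν
    rcases Finset.mem_union.mp (support_add hν) with h | h
    exacts [hp ν h, hq ν h]
  · rw [map_mul, aeval_X] at hν
    obtain ⟨ν₁, hν₁, ν₂, hν₂, rfl⟩ := Finset.mem_add.mp (support_mul _ _ hν)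
    exact (hp ν₁ hν₁).add (hG i ν₂ hν₂)

variable {a b : Fin N} {M : Fin N → MvPolynomial (Fin N) k}

/-- **The shift part is admissible**: the monomials of `X i + X_a·M i` are `ε_i` (no `t`, empty list) and `t·ε^e`
with `e` a monomial of `M i` (list `[e]`), provided `M i` is free of `X_a`. (derived here) [cite: Hauser2010, §D (p. 12)] -/
theorem twistAdm_shiftPart (hMa : ∀ i, i ≠ a → i ≠ b → a ∉ (M i).vars) {B : Finset (Fin N →₀ ℕ)}
    (hB : ∀ i, i ≠ a → i ≠ b → (M i).support ⊆ B) (i : Fin N) :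
    ∀ ν ∈ (shiftPart a b M i).support, TwistAdm a B ν := by
  classical
  intro ν hν
  by_cases hia : i = a
  · simp [shiftPart, hia] at hν
  by_cases hib : i = b
  · simp [shiftPart, hib] at hν
  rw [shiftPart_of_ne hia hib] at hν
  rcases Finset.mem_union.mp (support_add hν) with h | h
  · rw [support_X, Finset.mem_singleton] at h
    subst h
    exact ⟨[], by simp, by simp [hia], by simp⟩
  · rw [support_X_mul, Finset.mem_map] at h
    obtain ⟨e, he, rfl⟩ := h
    have hea : e a = 0 := apply_eq_zero_of_notMem_vars₄₆ (hMa i hia hib) he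
    refine ⟨[e], by simpa using hB i hia hib he, ?_, ?_⟩
    · simp [hea]
    · simp [hea, add_comm]

end Adm

/-! ## §3 Coefficient extraction under the absorber substitution -/

section Extract

variable (a b : Fin N) (S : ℕ)

/-- The **twisted exponent** of `μ`: replace `ε_b^{μ_b}` by `t^{S μ_b}` (`twistExp μ = μ − μ_b e_b + S μ_b e_a`).
(derived here) [cite: Hauser2010, §D (p. 12)] -/
def twistExp (μ : Fin N →₀ ℕ) : Fin N →₀ ℕ := μ.erase b + Finsupp.single a (S * μ b)

variable {a b S}

/-- `(twistExp μ)_a = μ_a + S μ_b`. (derived here) [cite: Hauser2010, §D (p. 12)] -/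
theorem twistExp_apply_self (hab : a ≠ b) (μ : Fin N →₀ ℕ) : twistExp a b S μ a = μ a + S * μ b := by
  rw [twistExp, Finsupp.add_apply, Finsupp.erase_ne hab, Finsupp.single_eq_same]

/-- `(twistExp μ)_b = 0`. (derived here) [cite: Hauser2010, §D (p. 12)] -/
theorem twistExp_apply_absorber (hab : a ≠ b) (μ : Fin N →₀ ℕ) : twistExp a b S μ b = 0 := by
  rw [twistExp, Finsupp.add_apply, Finsupp.erase_same, Finsupp.single_apply, if_neg hab, add_zero]

/-- `(twistExp μ)_i = μ_i` off `a, b`. (derived here) [cite: Hauser2010, §D (p. 12)] -/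
theorem twistExp_apply_of_ne {i : Fin N} (hia : i ≠ a) (hib : i ≠ b) (μ : Fin N →₀ ℕ) :
    twistExp a b S μ i = μ i := by
  rw [twistExp, Finsupp.add_apply, Finsupp.erase_ne hib, Finsupp.single_apply, if_neg (fun h => hia h.symm), add_zero]

/-- `twistExp` is injective on exponents free of `a` when `S ≥ 1` (`μ_b` is recovered as `(twistExp μ)_a / S`).
(derived here) [cite: Hauser2010, §D (p. 12)] -/
theorem twistExp_injective (hab : a ≠ b) (hS : 1 ≤ S) {μ ν : Fin N →₀ ℕ} (hμ : μ a = 0) (hν : ν a = 0)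
    (h : twistExp a b S μ = twistExp a b S ν) : μ = ν := by
  have hb : μ b = ν b := by
    have h1 := DFunLike.congr_fun h a
    rw [twistExp_apply_self hab, twistExp_apply_self hab, hμ, hν, zero_add, zero_add] at h1
    exact Nat.eq_of_mul_eq_mul_left hS h1
  ext i
  by_cases hia : i = a
  · rw [hia, hμ, hν]
  by_cases hib : i = b
  · rw [hib, hb]
  have h1 := DFunLike.congr_fun h i
  rwa [twistExp_apply_of_ne hia hib, twistExp_apply_of_ne hia hib] at h1

variable {c : k}

/-- **The absorber substitution on a monomial**: `(c' ε^μ)(ε_b := −c t^S) = c' (−c)^{μ_b} · ε^{twistExp μ}`.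
(derived here) [cite: Hauser2010, §D (p. 12)] -/
theorem aeval_absorberSubst_monomial (μ : Fin N →₀ ℕ) (r : k) :
    aeval (absorberSubst a b c S) (monomial μ r) = monomial (twistExp a b S μ) (r * (-c) ^ μ b) := by
  classical
  have hfix : aeval (absorberSubst a b c S) (monomial (μ.erase b) r) = monomial (μ.erase b) r := by
    by_cases hr : r = 0
    · simp [hr]
    · refine aeval_eq_self_of_notMem_vars₄₆ _ (fun j hj => absorberSubst_of_ne hj) ?_
      rw [vars_monomial hr, Finsupp.support_erase]
      exact Finset.notMem_erase b _
  conv_lhs => rw [← Finsupp.erase_add_single b μ, monomial_add_single, map_mul, map_pow, hfix, aeval_X,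
    absorberSubst_self]
  rw [twistExp, ← monomial_mul]
  congr 1
  rw [neg_mul_eq_neg_mul, ← map_neg, mul_pow, ← map_pow, ← pow_mul]
  exact C_mul_X_pow_eq_monomial

/-- **Coefficient extraction (E1 g29 §4.A (3): `[h₁]_j = (−1/c)^j D^{(j p^k)} [h₁]_0`, coefficientwise).**  For `Φ`
free of `X_a` and `μ ∈ supp Φ`:  `coeff (twistExp μ) (Φ(ε_b := −c t^S)) = coeff μ Φ · (−c)^{μ_b}` (`S ≥ 1`).
(derived here) [cite: Hauser2010, §D (p. 12)] -/
theorem coeff_twistExp_aeval_absorberSubst (hab : a ≠ b) (hS : 1 ≤ S) {Φ : MvPolynomial (Fin N) k}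
    (hΦ : a ∉ Φ.vars) {μ : Fin N →₀ ℕ} (hμ : μ ∈ Φ.support) :
    coeff (twistExp a b S μ) (aeval (absorberSubst a b c S) Φ) = coeff μ Φ * (-c) ^ μ b := by
  classical
  conv_lhs => rw [Φ.as_sum, map_sum]
  rw [coeff_sum]
  simp only [aeval_absorberSubst_monomial, coeff_monomial]
  rw [Finset.sum_eq_single μ]
  · rw [if_pos rfl]
  · intro ν hν hne
    rw [if_neg]
    intro heq
    exact hne (twistExp_injective hab hS (apply_eq_zero_of_notMem_vars₄₆ hΦ hν)
      (apply_eq_zero_of_notMem_vars₄₆ hΦ hμ) heq)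
  · intro h
    exact absurd hμ h

end Extract

/-! ## §4 The core inequality: an upper pin of the absorber has value `≥ (1 + S·d)·w_b` -/

section Core

variable {a b : Fin N} {M : Fin N → MvPolynomial (Fin N) k} {c : k} {S : ℕ}

/-- **Core inequality (E1 g29 §4.A step (4) in the model).**  Let `T = twistedTranslation a b M c S` with `a ≠ b`,
every `M i` (`i ≠ a, b`) free of `X_a, X_b` with all monomials of degree `≥ d`, `c ≠ 0`, `S ≥ 1`; let `Φ` be free of
`X_a` with `Φ ∘ T = Φ`; let `w ≥ 0` and `μ ∈ supp Φ` an UPPER PIN of `b`: `μ_b ≥ 1` and every variable of `μ` has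
weight `≥ w_b`.  Then `(1 + S·d)·w_b ≤ v_w(μ)`.
Proof: the twisted exponent `twistExp μ` (`t`-degree `S μ_b`) is a monomial of `Φ(ε + tM, ε_b := 0)` (KEY IDENTITY and
coefficient extraction), so it carries `S μ_b` monomials of the `M_i` below `μ` (divisibility); each has all its
variables among those of `μ`, hence value `≥ d·w_b`; so `v_w(μ) ≥ S μ_b d w_b + μ_b w_b ≥ (1 + S d) w_b`. (derived here)
[cite: Hauser2010, §D (p. 12)] [cite: AbramovichTemkinWlodarczyk2024, Def. 2.4.1 (2) (p. 1568), Thm. 5.3.1 (2) (p. 1578)] -/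
theorem le_monomialValuation_of_twistedTranslation (hab : a ≠ b)
    (hM : ∀ i, i ≠ a → i ≠ b → a ∉ (M i).vars ∧ b ∉ (M i).vars) (hc : c ≠ 0) (hS : 1 ≤ S) {d : ℕ}
    (hd : ∀ i, i ≠ a → i ≠ b → ∀ e ∈ (M i).support, d ≤ Finsupp.degree e)
    {Φ : MvPolynomial (Fin N) k} (hΦ : a ∉ Φ.vars) (hfix : aeval (twistedTranslation a b M c S) Φ = Φ)
    (w : Fin N → ℚ) (hw : ∀ i, 0 ≤ w i) {μ : Fin N →₀ ℕ} (hμ : μ ∈ Φ.support) (hμb : μ b ≠ 0)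
    (hpin : ∀ i, μ i ≠ 0 → w b ≤ w i) :
    (1 + (S : ℚ) * d) * w b ≤ monomialValuation w μ := by
  classical
  have hμa : μ a = 0 := apply_eq_zero_of_notMem_vars₄₆ hΦ hμ
  -- the twisted exponent is a monomial of `Φ(shiftPart)`
  have hνs : twistExp a b S μ ∈ (aeval (shiftPart a b M) Φ).support := by
    rw [aeval_shiftPart_eq_aeval_absorberSubst hab (fun i hia hib => (hM i hia hib).2) hΦ hfix, mem_support_iff,
      coeff_twistExp_aeval_absorberSubst hab hS hΦ hμ]
    exact mul_ne_zero (mem_support_iff.mp hμ) (pow_ne_zero _ (neg_ne_zero.mpr hc))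
  -- divisibility
  set B : Finset (Fin N →₀ ℕ) := (Finset.univ.filter fun i => i ≠ a ∧ i ≠ b).biUnion fun i => (M i).support
    with hB
  have hBsub : ∀ i, i ≠ a → i ≠ b → (M i).support ⊆ B := fun i hia hib e he =>
    Finset.mem_biUnion.mpr ⟨i, Finset.mem_filter.mpr ⟨Finset.mem_univ i, hia, hib⟩, he⟩
  obtain ⟨l, hlB, hlen, hle⟩ := twistAdm_of_mem_support_aeval a B (shiftPart a b M)
    (twistAdm_shiftPart (fun i hia hib => (hM i hia hib).1) hBsub) Φ _ hνs
  -- coordinates of the twisted exponent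
  have hνa : twistExp a b S μ a = S * μ b := by rw [twistExp_apply_self hab, hμa, zero_add]
  have hνb : twistExp a b S μ b = 0 := twistExp_apply_absorber hab μ
  rw [hνa] at hlen hle
  -- `l.sum` vanishes at `a` and `b` and lies below `μ` elsewhere
  have hsum_a : l.sum a = 0 := by
    have h1 := Finsupp.le_def.mp hle a
    rw [Finsupp.add_apply, Finsupp.single_eq_same, hνa] at h1
    omega
  have hsum_b : l.sum b = 0 := by
    have h1 := Finsupp.le_def.mp hle b
    rw [Finsupp.add_apply, Finsupp.single_apply, if_neg hab, hνb] at h1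
    omega
  have hsum_le : ∀ i, i ≠ a → i ≠ b → l.sum i ≤ μ i := by
    intro i hia hib
    have h1 := Finsupp.le_def.mp hle i
    rw [Finsupp.add_apply, twistExp_apply_of_ne hia hib] at h1
    exact le_trans (Nat.le_add_right _ _) h1
  -- every list element has degree `≥ d` and all its variables of weight `≥ w b`
  have hval : ∀ e ∈ l, (d : ℚ) * w b ≤ monomialValuation w e := by
    intro e he
    have hel : e ≤ l.sum := List.le_sum_of_mem he
    obtain ⟨i, hi, hei⟩ := Finset.mem_biUnion.mp (hlB e he)
    obtain ⟨-, hia, hib⟩ := Finset.mem_filter.mp hi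
    have hdeg : (d : ℚ) ≤ ((Finsupp.degree e : ℕ) : ℚ) := by exact_mod_cast hd i hia hib e hei
    refine le_trans (mul_le_mul_of_nonneg_right hdeg (hw b))
      (degree_mul_le_monomialValuation₄₆ w e fun j hj => ?_)
    have hle_j : e j ≤ l.sum j := Finsupp.le_def.mp hel j
    have hja : j ≠ a := by
      intro hja
      rw [hja, hsum_a] at hle_j
      exact hj (hja ▸ Nat.eq_zero_of_le_zero hle_j)
    have hjb : j ≠ b := by
      intro hjb
      rw [hjb, hsum_b] at hle_j
      exact hj (hjb ▸ Nat.eq_zero_of_le_zero hle_j)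
    apply hpin j
    have h2 := hsum_le j hja hjb
    omega
  -- sum over the list: `S μ_b · d w_b ≤ v_w(l.sum)`
  have hlist : (S : ℚ) * μ b * (d * w b) ≤ monomialValuation w l.sum := by
    rw [monomialValuation_list_sum₄₆]
    have hx : ∀ x ∈ l.map (monomialValuation w), (d : ℚ) * w b ≤ x := by
      intro x hx
      obtain ⟨e, he, rfl⟩ := List.mem_map.mp hx
      exact hval e he
    have h1 := length_mul_le_sum₄₆ _ _ hx
    rw [List.length_map, hlen, Nat.cast_mul] at h1
    exact h1
  -- `μ` dominates `l.sum + μ_b e_b`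
  have hdom : l.sum + Finsupp.single b (μ b) ≤ μ := by
    refine Finsupp.le_def.mpr fun i => ?_
    rw [Finsupp.add_apply]
    by_cases hib : i = b
    · rw [hib, hsum_b, Finsupp.single_eq_same, zero_add]
    · rw [Finsupp.single_apply, if_neg (fun h => hib h.symm), add_zero]
      by_cases hia : i = a
      · rw [hia, hsum_a, hμa]
      · exact hsum_le i hia hib
  -- conclusion
  have hμb1 : (1 : ℚ) ≤ μ b := by exact_mod_cast Nat.one_le_iff_ne_zero.mpr hμb
  have hnn : (0 : ℚ) ≤ (1 + (S : ℚ) * d) * w b := mul_nonneg (by positivity) (hw b)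
  calc (1 + (S : ℚ) * d) * w b ≤ (μ b : ℚ) * ((1 + (S : ℚ) * d) * w b) := le_mul_of_one_le_left hnn hμb1
    _ = S * μ b * (d * w b) + μ b * w b := by ring
    _ ≤ monomialValuation w l.sum + monomialValuation w (Finsupp.single b (μ b)) := by
        rw [monomialValuation_single₄₆]
        exact add_le_add hlist le_rfl
    _ = monomialValuation w (l.sum + Finsupp.single b (μ b)) := (monomialValuation_add₄₆ w _ _).symm
    _ ≤ monomialValuation w μ := monomialValuation_mono₄₆ w hw hdom

end Core

/-! ## §5 THEOREM R in the model: twist depth under a maximal centre -/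

section Model

variable {a b : Fin N} {M : Fin N → MvPolynomial (Fin N) k} {c : k} {S : ℕ}

/-- **The absorber's degree**: if the degree-`D_b` layer of some `P` is `X b + c·X_a^S` with `c ≠ 0`, then
`S·D_a = D_b` (the monomial `t^S` has degree `D_b`); in the θ-grading this is `w_b = S·θ`. (derived here)
[cite: AbramovichTemkinWlodarczyk2024, Rem. 2.4.2 (p. 1568), §3.4 (p. 1570)] -/
theorem weight_eq_of_top_absorber (hab : a ≠ b) (hc : c ≠ 0) (D : Fin N → ℕ) {P : MvPolynomial (Fin N) k}
    (htop : weightedHomogeneousComponent D (D b) P = X b + C c * X a ^ S) : S * D a = D b := by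
  classical
  have hR : coeff (Finsupp.single a S) (X b + C c * X a ^ S : MvPolynomial (Fin N) k) = c := by
    have hne : Finsupp.single b 1 ≠ Finsupp.single a S := by
      intro h
      have h1 := DFunLike.congr_fun h b
      rw [Finsupp.single_eq_same, Finsupp.single_apply, if_neg hab] at h1
      exact one_ne_zero h1
    rw [coeff_add, coeff_C_mul, coeff_X_pow, if_pos rfl, mul_one, coeff_X, if_neg hne, zero_add]
  have h1 := congrArg (coeff (Finsupp.single a S)) htop
  rw [hR, coeff_weightedHomogeneousComponent] at h1
  by_contra hne
  rw [if_neg] at h1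
  · exact hc h1.symm
  · rwa [Finsupp.weight_single, smul_eq_mul]

/-- **THEOREM R (twist depth) in the `W(f)` model.**  Let `(Ψ, w)` be a centre for `f = X_a^q + h` (`h` free of `X_a`,
`q ≥ 1`) attaining `max W(f)`, with ambient coordinates `Y i = Ψ⁻¹ Xᵢ` in inverse normal form relative to `a`; let `D`
be the θ-grading (`D a = L > 0`, `D_i θ = L w_i`, `E₀ θ = L`, `w_a < θ`) dominated by `Y`, and assume the centre is NOT
`T`-tight: `1 < q·θ`.  Suppose the maximal-rate parts form a twisted translation, `θ_Y = twistedTranslation a b M c S`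
(`a ≠ b`, `c ≠ 0`, `S ≥ 1`, every `M i` free of `X_a, X_b` with all monomials of degree `≥ d`), and `b` is a slot
(`w_b > 0`).  Then `(1 + S·d)·S·θ ≤ 1`.
Proof: Lemma Q (`face_equation`, indicator `0` since `q θ ≠ 1`) says the face `h₀` is fixed by `T`; maximality pins `b`
from above (`exists_upperPin_of_isMaxInv`, E1's L3) by a face monomial `μ` (`μ_a = 0` as `w_a < θ ≤ S θ = w_b`, so
`μ ∈ supp h₀`); the core inequality gives `(1 + S d) w_b ≤ v_w(μ) = 1` with `w_b = S θ`. (derived here)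
[cite: AbramovichTemkinWlodarczyk2024, Thm. 5.3.1 (2) (p. 1578), Lemma 5.2.10 (p. 1577), Def. 2.4.1 (2) (p. 1568)]
[cite: Hauser2010, §D (p. 12)] [cite: AbramovichQuekSchober2025, Thm. 3.5] -/
theorem twistDepth_mul_theta_le_one {Ψ : MvPolynomial (Fin N) k ≃ₐ[k] MvPolynomial (Fin N) k} (hab : a ≠ b)
    (hY : IsInverseNormalForm a (fun i => Ψ.symm (X i))) {h : MvPolynomial (Fin N) k} (hh : a ∉ h.vars)
    {q : ℕ} (hq : 0 < q) {w : Fin N → ℚ} (hcen : IsCentreFor (X a ^ q + h) Ψ w)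
    (hmax : IsMaxInv (admissibleInvariants (X a ^ q + h)) (exps w)) (θ : ℚ) (L : ℕ) (D : Fin N → ℕ)
    (hL : 0 < L) (hDa : D a = L) (hD : ∀ i, i ≠ a → (D i : ℚ) * θ = L * w i) {E₀ : ℕ}
    (hE₀ : (E₀ : ℚ) * θ = L) (hθ : w a < θ) (hqθ : 1 < (q : ℚ) * θ)
    (hdom : ∀ i, (D i : ℕ∞) ≤ monomialOrd D (Ψ.symm (X i)))
    (hM : ∀ i, i ≠ a → i ≠ b → a ∉ (M i).vars ∧ b ∉ (M i).vars) (hc : c ≠ 0) (hS : 1 ≤ S) {d : ℕ}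
    (hd : ∀ i, i ≠ a → i ≠ b → ∀ e ∈ (M i).support, d ≤ Finsupp.degree e)
    (htop : ∀ i, weightedHomogeneousComponent D (D i) (Ψ.symm (X i)) = twistedTranslation a b M c S i)
    (hwb : 0 < w b) :
    (1 + (S : ℚ) * d) * S * θ ≤ 1 := by
  classical
  have hwa : 0 ≤ w a := hcen.2.1 a
  have hθpos : 0 < θ := lt_of_le_of_lt hwa hθ
  have hL' : (0 : ℚ) < L := by exact_mod_cast hL
  -- (i) the absorber weight `w b = S θ`
  have hSD : S * D a = D b :=
    weight_eq_of_top_absorber hab hc D ((htop b).trans (twistedTranslation_absorber hab))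
  have hwbS : w b = S * θ := by
    have h1 := hD b hab.symm
    rw [← hSD, hDa, Nat.cast_mul] at h1
    have h2 : (L : ℚ) * w b = L * (S * θ) := by rw [← h1]; ring
    exact mul_left_cancel₀ hL'.ne' h2
  -- (ii) the upper pin of `b`
  obtain ⟨μ, hμs, hv, hμb, hpin⟩ := exists_upperPin_of_isMaxInv hcen hmax hwb
  have hμa : μ a = 0 := by
    by_contra hne
    have h1 := hpin a hne
    have h2 : θ ≤ S * θ := le_mul_of_one_le_left hθpos.le (by exact_mod_cast hS)
    linarith
  have hF : Ψ.symm (X a ^ q + h) = X a ^ q + aeval (fun i => Ψ.symm (X i)) h := by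
    rw [algEquiv_symm_eq_aeval, hY.aeval_X_pow_add]
  have hμh : coeff μ h ≠ 0 := by
    have h1 := mem_support_iff.mp hμs
    rw [hF, coeff_add, coeff_X_pow, if_neg, zero_add, hY.coeff_aeval_of_apply_eq_zero h hμa] at h1
    · exact h1
    · intro heq
      have h2 := DFunLike.congr_fun heq a
      rw [Finsupp.single_eq_same, hμa] at h2
      exact hq.ne' h2
  -- (iii) the face and Lemma Q
  have hμΦ : μ ∈ (weightedHomogeneousComponent D E₀ h).support := by
    rw [mem_support_iff, coeff_weightedHomogeneousComponent_eq_face w θ L D hL hDa hD hθpos.ne' hE₀ hh μ, if_pos hv]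
    exact hμh
  have hΦa : a ∉ (weightedHomogeneousComponent D E₀ h).vars := notMem_vars_weightedHomogeneousComponent₄₆ hh D E₀
  have hadm : IsAdmissibleFor w (X a ^ q + aeval (fun i => Ψ.symm (X i)) h) := hF ▸ hcen.2.2
  have hface := hY.face_equation w θ L D hL hDa hD hθ hwa hE₀ hdom hh hq hadm
  have hind : ¬ (q * L = E₀) := by
    intro hqe
    have h1 : (q : ℚ) * θ * L = 1 * L := by
      rw [one_mul]
      nth_rewrite 2 [← hE₀]
      rw [← hqe, Nat.cast_mul]
      ring
    have h2 : (q : ℚ) * θ = 1 := mul_right_cancel₀ hL'.ne' h1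
    linarith
  have hT : (fun i => weightedHomogeneousComponent D (D i) (Ψ.symm (X i))) = twistedTranslation a b M c S :=
    funext htop
  have hfix : aeval (twistedTranslation a b M c S) (weightedHomogeneousComponent D E₀ h) =
      weightedHomogeneousComponent D E₀ h := by
    rw [← hT]
    simpa [hind] using hface
  -- (iv) the core inequality at the pin
  have hcore := le_monomialValuation_of_twistedTranslation hab hM hc hS hd hΦa hfix w hcen.2.1 hμΦ hμb hpin
  rw [hv, hwbS] at hcore
  calc (1 + (S : ℚ) * d) * S * θ = (1 + (S : ℚ) * d) * (S * θ) := by ring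
    _ ≤ 1 := hcore

/-- **THEOREM R, integer form: `(1 + S·d)·S < q`** (from `(1 + S d) S θ ≤ 1 < q θ`).  With `S = p^k` this is E1's
`q > p^k (d p^k + 1)`. (derived here) [cite: AbramovichTemkinWlodarczyk2024, Thm. 5.3.1 (2) (p. 1578)]
[cite: Hauser2010, §D (p. 12)] [cite: AbramovichQuekSchober2025, Thm. 3.5] -/
theorem twistDepth_mul_lt {Ψ : MvPolynomial (Fin N) k ≃ₐ[k] MvPolynomial (Fin N) k} (hab : a ≠ b)
    (hY : IsInverseNormalForm a (fun i => Ψ.symm (X i))) {h : MvPolynomial (Fin N) k} (hh : a ∉ h.vars)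
    {q : ℕ} (hq : 0 < q) {w : Fin N → ℚ} (hcen : IsCentreFor (X a ^ q + h) Ψ w)
    (hmax : IsMaxInv (admissibleInvariants (X a ^ q + h)) (exps w)) (θ : ℚ) (L : ℕ) (D : Fin N → ℕ)
    (hL : 0 < L) (hDa : D a = L) (hD : ∀ i, i ≠ a → (D i : ℚ) * θ = L * w i) {E₀ : ℕ}
    (hE₀ : (E₀ : ℚ) * θ = L) (hθ : w a < θ) (hqθ : 1 < (q : ℚ) * θ)
    (hdom : ∀ i, (D i : ℕ∞) ≤ monomialOrd D (Ψ.symm (X i)))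
    (hM : ∀ i, i ≠ a → i ≠ b → a ∉ (M i).vars ∧ b ∉ (M i).vars) (hc : c ≠ 0) (hS : 1 ≤ S) {d : ℕ}
    (hd : ∀ i, i ≠ a → i ≠ b → ∀ e ∈ (M i).support, d ≤ Finsupp.degree e)
    (htop : ∀ i, weightedHomogeneousComponent D (D i) (Ψ.symm (X i)) = twistedTranslation a b M c S i)
    (hwb : 0 < w b) :
    (1 + S * d) * S < q := by
  have h1 := twistDepth_mul_theta_le_one hab hY hh hq hcen hmax θ L D hL hDa hD hE₀ hθ hqθ hdom hM hc hS hd htop hwb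
  have hθpos : 0 < θ := lt_of_le_of_lt (hcen.2.1 a) hθ
  have h2 : ((1 + S * d) * S : ℚ) < q := by
    by_contra hle
    have h3 := mul_le_mul_of_nonneg_right (not_lt.mp hle) hθpos.le
    linarith
  exact_mod_cast h2

end Model

/-! ## §6 Arithmetic consequences and sharpness -/

section Arith

/-- **Depth law `e ≥ 2k + 1`**: if `S = p^κ`, `d ≥ 1`, `q = p^e` (`p ≥ 2`) and `(1 + S d) S < q`, then `2κ + 1 ≤ e`
(`p^{2κ} < p^{2κ} + p^κ ≤ (1 + p^κ d) p^κ < p^e`). (derived here) [cite: Hauser2010, §D (p. 12)] -/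
theorem twistDepth_exponent {p κ e d : ℕ} (hp : 2 ≤ p) (hd : 1 ≤ d) (h : (1 + p ^ κ * d) * p ^ κ < p ^ e) :
    2 * κ + 1 ≤ e := by
  by_contra hlt
  have h1 : p ^ e ≤ p ^ (2 * κ) := Nat.pow_le_pow_right (by omega) (by omega)
  have h2 : p ^ (2 * κ) = p ^ κ * p ^ κ := by rw [two_mul, pow_add]
  have h3 : p ^ κ * p ^ κ ≤ (1 + p ^ κ * d) * p ^ κ := by
    apply Nat.mul_le_mul_right
    calc p ^ κ = p ^ κ * 1 := (mul_one _).symm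
      _ ≤ p ^ κ * d := Nat.mul_le_mul_left _ hd
      _ ≤ 1 + p ^ κ * d := Nat.le_add_left _ _
  exact lt_irrefl _ (lt_of_lt_of_le h (h1.trans (h2.le.trans h3)))

/-- **At `q = p²` the mechanism bends no maximal centre**: with `κ ≥ 1` and `d ≥ 1`, `(1 + p^κ d) p^κ < p²` is
impossible. (derived here) [cite: Hauser2010, §D (p. 12)] -/
theorem not_twistDepth_at_sq {p κ d : ℕ} (hp : 2 ≤ p) (hκ : 1 ≤ κ) (hd : 1 ≤ d) :
    ¬ (1 + p ^ κ * d) * p ^ κ < p ^ 2 := fun h => by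
  have := twistDepth_exponent hp hd h
  omega

end Arith

section Sharp

variable (p m : ℕ)

variable (k) in
/-- The sharp face `X₁^p + X₂^{mp}·X₃` (`Fin 4`; up to the sign of the last term this is the face `bentEll` of
`WeightedCentreBentFamilyRankOne`). (cell's family, engine 1 gen 28/29) [cite: Hauser2010, §C (p. 9), §D (p. 12)] -/
def sharpFace : MvPolynomial (Fin 4) k := X 1 ^ p + X 2 ^ (m * p) * X 3

variable (k) in
/-- The shifts of the sharp instance: `M 1 = X₂^m`, all others `0`. (derived here) [cite: Hauser2010, §D (p. 12)] -/
def sharpM : Fin 4 → MvPolynomial (Fin 4) k := fun i => if i = 1 then X 2 ^ m else 0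

/-- The weights `(0; 1/p, 1/(mp+1), 1/(mp+1))` of the sharp instance. (derived here)
[cite: AbramovichTemkinWlodarczyk2024, §5.1 (p. 1575)] -/
def sharpWeights : Fin 4 → ℚ :=
  fun i => if i = 0 then 0 else if i = 1 then 1 / p else 1 / (m * p + 1)

/-- The pin `X₂^{mp}·X₃` of the sharp instance. (derived here) [cite: AbramovichTemkinWlodarczyk2024, Thm. 5.3.1 (2) (p. 1578)] -/
def sharpPin : Fin 4 →₀ ℕ := Finsupp.single 2 (m * p) + Finsupp.single 3 1

/-- In characteristic `p` the twisted translation `T = (t; X₁ + t·X₂^m, X₂, X₃ − t^p)` (absorber `b = 3`, `c = −1`,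
`S = p`, `M 1 = X₂^m`) FIXES the sharp face: `(X₁ + t X₂^m)^p + X₂^{mp}(X₃ − t^p) = X₁^p + X₂^{mp} X₃`. (derived here)
[cite: Hauser2010, §D (p. 12)] -/
theorem aeval_twistedTranslation_sharpFace [hp : Fact p.Prime] [CharP k p] :
    aeval (twistedTranslation 0 3 (sharpM k m) (-1 : k) p) (sharpFace k p m) = sharpFace k p m := by
  have h1 : twistedTranslation 0 3 (sharpM k m) (-1 : k) p 1 = X 1 + X 0 * X 2 ^ m := by
    rw [twistedTranslation_of_ne (by decide) (by decide)]
    simp [sharpM]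
  have h2 : twistedTranslation 0 3 (sharpM k m) (-1 : k) p 2 = X 2 := by
    rw [twistedTranslation_of_ne (by decide) (by decide)]
    simp [sharpM]
  have h3 : twistedTranslation 0 3 (sharpM k m) (-1 : k) p 3 = X 3 - X 0 ^ p := by
    rw [twistedTranslation_absorber (by decide), map_neg, map_one]
    ring
  simp only [sharpFace, map_add, map_mul, map_pow, aeval_X, h1, h2, h3]
  rw [add_pow_char, mul_pow, ← pow_mul]
  ring

/-- The data of the sharp instance satisfy the hypotheses of the core inequality with `d = m`: `M` free of `X₀, X₃`,
monomials of degree `≥ m`, the pin lies in the face with `X₃`-exponent `1`, all its variables have weight `≥ w₃`.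
(derived here) [cite: Hauser2010, §D (p. 12)] -/
theorem sharp_hypotheses :
    (∀ i : Fin 4, i ≠ 0 → i ≠ 3 → (0 : Fin 4) ∉ (sharpM k m i).vars ∧ (3 : Fin 4) ∉ (sharpM k m i).vars) ∧
    (∀ i : Fin 4, i ≠ 0 → i ≠ 3 → ∀ e ∈ (sharpM k m i).support, m ≤ Finsupp.degree e) ∧
    sharpPin p m ∈ (sharpFace k p m).support ∧ sharpPin p m 3 ≠ 0 ∧
    (∀ i, sharpPin p m i ≠ 0 → sharpWeights p m 3 ≤ sharpWeights p m i) := by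
  classical
  refine ⟨fun i _ _ => ?_, fun i _ _ e he => ?_, ?_, by simp [sharpPin], fun i hi => ?_⟩
  · by_cases hi : i = 1
    · subst hi
      constructor <;>
      · simp only [sharpM]
        intro hv
        have := vars_pow (X 2 : MvPolynomial (Fin 4) k) m hv
        rw [vars_X] at this
        exact absurd (Finset.mem_singleton.mp this) (by decide)
    · simp [sharpM, hi]
  · by_cases hi : i = 1
    · subst hi
      simp only [sharpM] at he
      rw [X_pow_eq_monomial] at he
      have := support_monomial_subset he
      rw [Finset.mem_singleton] at this
      subst this
      simp
    · simp [sharpM, hi] at he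
  · rw [mem_support_iff, sharpFace, sharpPin, coeff_add, coeff_X_pow, if_neg, zero_add, X_pow_eq_monomial,
      X, monomial_mul, coeff_monomial, if_pos rfl]
    · simp
    · intro h
      have := DFunLike.congr_fun h 3
      simp at this
  · fin_cases i <;> simp [sharpPin, sharpWeights] at hi ⊢

/-- **Sharpness of the core inequality.**  For the sharp instance (`b = 3`, `S = p`, `d = m`, `w₃ = 1/(mp+1)`):
`(1 + p·m)·w₃ = 1 = v_w(X₂^{mp} X₃)` — EQUALITY in `le_monomialValuation_of_twistedTranslation`.  Consequently the
strict bound of `twistDepth_mul_lt` reads `p(mp+1) < q`, i.e. `mp + 1 < q/p`, exactly the hypothesis under which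
`WeightedCentreBentFamilyRankOne.exists_isTTight_and_not_isTTight_centre` exhibits a bent maximal centre of this
shape for `q = p^{c+1}`. (derived here) [cite: Hauser2010, §D (p. 12)] [cite: AbramovichTemkinWlodarczyk2024, Thm. 5.3.1 (2) (p. 1578)] -/
theorem sharp_core_equality :
    (1 + (p : ℚ) * m) * sharpWeights p m 3 = 1 ∧ monomialValuation (sharpWeights p m) (sharpPin p m) = 1 := by
  have hden : ((m : ℚ) * p + 1) ≠ 0 := by positivity
  have h2 : sharpWeights p m 2 = 1 / ((m : ℚ) * p + 1) := by simp [sharpWeights]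
  have h3 : sharpWeights p m 3 = 1 / ((m : ℚ) * p + 1) := by simp [sharpWeights]
  constructor
  · rw [h3, one_div, show (1 + (p : ℚ) * m) = (m : ℚ) * p + 1 by ring]
    exact mul_inv_cancel₀ hden
  · rw [sharpPin, monomialValuation_add₄₆, monomialValuation_single₄₆, monomialValuation_single₄₆, h2, h3,
      Nat.cast_mul, Nat.cast_one, one_mul, mul_one_div, ← add_div]
    exact div_self hden

end Sharp

end WeightedBlowup

end Literature.AlgebraicGeometry.Resolution
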